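/-
Copyright (c) 2026 the pub-hodgecm-mathlib formalisation cell (harness21).  Prover seat hodgecm-mathlib-K2Liu-p08 (g6), Track B «K2-LIT»,
#184♮ = hLiu418 = `stmt-HodgeConjecture-24832`; #42S BLOCK D, row D-2, (σ-A) mini-road (LEAD F0P6-plan (g15) RULING M-160f ∕ BATCH #238; (σ-A) road desk
K2Liu-p25 (g3) WORD #4 «RE-SOCKET «=»»), brick [A4-close]: THE CONE-WORD CLOSER and the D-2 SOCKET OF RECORD `hV_faces_of_coneWord`.
THEOREMS ONLY (no `def`, no `instance`, no `notation`, no named-fact hypothesis, no `sorry`, default heartbeats).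
-/
import Summits.HodgeConjecture.HodgeConjecture.Theorems.K2LiuIncoherentRankOneBadPlaceSeamComposite   -- ★ p864226 (σ-C): the frame and `hV` bytes; brings ★ p863521 (`hVdef′`, `conj_coe_addChar`), ★ p863405 (ball family), ★ W1-fin-a
import Literature.NumberTheory.LocalFields.CompleteValuedSquareRootNearOne                            -- ★ `isSquare_of_valued_sub_one_lt_four_adicCompletion` (square roots near `1` in `K_v`)
import Literature.NumberTheory.QuadraticForms.HilbertReciprocityFiniteness                             -- ★ `hilbertSymbol_mul_sq_left` (square classes)
import Literature.NumberTheory.Automorphic.AddCharConductorExponent                                    -- ★ `AddChar.HasConductorExp.mulShift`, `primePowBall` ↔ `Valued.v`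
import Literature.NumberTheory.QuadraticForms.HilbertSymbolBilinear                                    -- ★ `hilbertSymbol_adicCompletion_mul_left` (bimultiplicativity at `v`)
import Literature.NumberTheory.Rogawski1990.RamifiedPlaceNormSymbolDichotomy                           -- ★ `hilbertSymbol_eq_one_iff_exists_norm_toPlace` (local norms ↔ `(·, θ)_v = 1`)
import HarnessLib

-- buildfix G11b-3 recipe (LEDGER B13-1/B13-3), as in the GelbartRogawski1991 siblings: elaborate sequentially.
set_option Elab.async false

/-!
# Crux `HLiu418`, #42S BLOCK D, row D-2 — brick [A4-close]: THE CONE-WORD CLOSER (generic) and THE D-2 SOCKET OF RECORD `hV_faces_of_coneWord`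

Cell `hodgecm-mathlib`, crux item hLiu418 = `stmt-HodgeConjecture-24832` (helper lane `--supports … --as helper`, count-neutral; closes no socket); squad K2 ∕ K2Liu (L1).
Prover K2Liu-p08 (g6) = typing pen of [A4] under the (σ-A) road desk K2Liu-p25 (g3) (WORD #4: finding adopted, re-socket «=»); LEAD F0P6-plan (g15) BATCH #238.

THE ROAD (census K2Liu-p08 (g6) 2026-09-05, Kudla–Rallis read in the cell's stage order).  The stage-B value at the #42S corner is a CONE WORD
  `N₂val(x) = γ · ∫_Z ψ_v(x · q z) · G z ∂ρ`
— `ρ` the stage functional as a Radon measure on `V′_v × V′_v` carried by the incidence variety `Z° = {s ≠ 0, ⟨s,s⟩ = 0, ⟨s,t⟩ = 0}`, `q(s,t) = ⟨t,t⟩`, `G = Φ_h`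
([A4-an], by value here) — and on `Z°` the phase values lie in `{0} ∪ (class of −det V′_v)` (★ [A4-alg] `K2LiuIsotropicOrthogonalNormClass`, Witt).  At a DEAD bad place
the Whittaker parameter `σc` is NOT in that class (`(−σc·a⁻¹, θ)_v = −1`).  THIS FILE closes row D-2's `hV` letter from exactly these three letters:
* §1 SEPARATION (pure local algebra, `K_v` any completion of a number field): **`valued_four_mul_le_valued_sub_of_hilbertSymbol`** — if `(−β′·a⁻¹, θ)_v = −1`, `β′ ≠ 0`, then
  every `u` with `u = 0 ∨ (−u·a⁻¹, θ)_v = 1` satisfies `|u − β′|_v ≥ |4β′|_v` (else `u∕β′ ∈ 1 + 4𝔭` is a square, ★ `isSquare_of_valued_sub_one_lt_four_adicCompletion`, and the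
  two symbols would agree, ★ `hilbertSymbol_mul_sq_left`): the dead class is UNIFORMLY separated from the live values.
* §2 UNIFORM NON-TRIVIALITY: **`exists_forall_exists_addChar_ne_one`** — for `ψ` of conductor exponent `d` and `b ≠ 0` there is ONE `k₁ = k₁(b, d)` such that for every `k ≥ k₁`
  and EVERY `y` with `|y|_v ≥ |b|_v`, `x ↦ ψ(y·x)` is non-trivial on `𝔭^{−k}` (★ `HasConductorExp.mulShift`: `ψ(y·)` has level `d − v(y)`).
* §3 THE GENERIC CONE-WORD CLOSER **`exists_forall_setIntegral_conj_addChar_mul_coneWord_eq_zero`**: `Z` ANY measurable space, `ρ` s-finite, `G ∈ L¹(ρ)`, `q` measurable,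
  `V x = γ·∫_Z ψ(x·q z)·G z ∂ρ`, support letter `∀ᵐ z ∂ρ, q z = 0 ∨ (−q z·a⁻¹, θ)_v = 1`, class letter `(−β′·a⁻¹, θ)_v = −1`, `β′ ≠ 0`
  ⊢ **`∃ k₁, ∀ k ≥ k₁, ∫_{𝔭^{−k}} conj ψ(β′x) · V x ∂μ = 0`** — Fubini (★ W1-fin-a `setIntegral_integral_mul_addChar_swap`), then the inner character integral
  `∫_{𝔭^{−k}} ψ((q z − β′)x) dμ` vanishes for `ρ`-a.e. `z` SIMULTANEOUSLY once `k ≥ k₁(4β′, d)` (§1 + §2 + ★ `setIntegral_addChar_eq_zero_of_exists`); `k₁` depends on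
  `(β′, d_ψ)` only — no compact support, no continuity in `z`, no line model.
* §4 **`hV_faces_of_coneWord`** — THE D-2 SOCKET OF RECORD on the ball road (desk WORD #4 (2)): ★ p864226 §3 `hV_faces_of_lineWord`'s frame
  (`S₁ val I Tf V`, Haar `μ`, corner scalars `σc ≠ 0`, the ball currency `hVdef′` in ★ p863521's BYTES) with the LINE data `(T E″ τ a γ Φl) hword hclass` REPLACED by the
  CONE data BY VALUE — spaces `Z v`, measures `ρ`, densities `G ∈ L¹`, phases `q`, scalars `γ`, class scalars `a` — and the three letters `hcone` ([A4-an]), `hZ` ([A4-alg] on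
  [A4-an]'s carrier), `hclass′ : dead ⇒ (−σc X v·(a X j h v)⁻¹, θ)_v = −1` (★ p863939 `hilbertSymbol_eq_neg_one_of_dead` with `u := −σc X v·(a X j h v)⁻¹`)
  ⟹ ★ p863475's `hV` binder BYTES (`dead → ∃ k₁, ∀ k ≥ k₁, V X j h i v k = 0`).
[KudlaRallis1994, §2 (2.10)–(2.12)] [MoeglinVignerasWaldspurger1987, Chap. 2 II.6] [BushnellHenniart2006, §1.7] [Serre1979, Ch. XIV §4] [Omeara1963, §63B].
HONEST LABEL.  Count-neutral helper; `hcone` ∕ `hZ`'s carrier statement ([A4-an]: cone measure, linear Fourier inversion, Fubini at the vertex) and `hclass′`'s (o1)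
congruence enter BY VALUE; `HC_CM` is proved only modulo the 7 printed citations (2 remaining named inputs: hLiu418 = `stmt-HodgeConjecture-24832`,
h413 = `stmt-HodgeConjecture-24833`) until rung 0 closes.  NOT here: [A4-an] (the Radon presentation of the stage functional).

## References
* [KudlaRallis1994] S. Kudla, S. Rallis, *A regularized Siegel–Weil formula: the first term identity*, Ann. of Math. 140 (1994), §2 (2.10)–(2.12).
* [MoeglinVignerasWaldspurger1987] C. Mœglin, M.-F. Vignéras, J.-L. Waldspurger, LNM 1291 (1987), Chap. 2 II.6.
* [BushnellHenniart2006] C. J. Bushnell, G. Henniart, *The local Langlands conjecture for GL(2)* (2006), §1.7 (level of `aψ`).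
* [Serre1979] J.-P. Serre, *Local Fields* (1979), Ch. XIV §4 (squares near `1`).
* [Omeara1963] O. T. O'Meara, *Introduction to Quadratic Forms* (1963), §63B (Hilbert symbol and square classes).
-/

set_option autoImplicit false
set_option linter.dupNamespace false -- the mandated namespace repeats `HodgeConjecture.HodgeConjecture`

noncomputable section

open scoped Matrix ComplexConjugate NNReal
open NumberField IsDedekindDomain Matrix MeasureTheory Set Filter
open Literature.NumberTheory.QuadraticForms Literature.NumberTheory.Automorphic Literature.NumberTheory.Automorphic.UnitaryGroup
open Literature.NumberTheory.Automorphic.UnitaryGroup.QuadraticCoordinates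
open Literature.NumberTheory.GaloisRepresentations Literature.NumberTheory.GaloisRepresentations.IsNonarchimedeanLocalField
open Literature.NumberTheory.GelbartRogawski1991 Literature.NumberTheory.GelbartRogawski1991.GRConstruction
open Summit.HodgeConjecture.HodgeConjecture.Cruxes.HLiu418.K2LiuOscillatoryBallLocalisation

namespace Summit.HodgeConjecture.HodgeConjecture.Cruxes.HLiu418.K2LiuLocalSWSeamOfRecord

open K2LiuSiegelUnipotentFourierDefs
open K2LiuIncoherentRankOneBadPlaceSeam (conj_coe_addChar)
open K2LiuIncoherentRankOneBadPlaceVanishingRow (exists_addSubgroupFamily_primePowBall)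

/-! ## §1 Separation: the dead square class is uniformly far from `{0} ∪ {live class}` -/

section Separation

variable (K : Type) [Field K] [NumberField K] (v : HeightOneSpectrum (𝓞 K))

/-- `|n|_v ≤ 1` for a natural number `n` (ultrametric induction). [folklore] -/
private theorem valued_natCast_le_one (n : ℕ) : Valued.v ((n : v.adicCompletion K)) ≤ 1 := by
  induction n with
  | zero => simp
  | succ k ih =>
    rw [Nat.cast_succ]
    exact Valuation.map_add_le _ ih (by rw [Valuation.map_one])

/-- **SEPARATION OF THE DEAD CLASS.**  In `K_v`: if `β′ ≠ 0` has `(−β′·a⁻¹, θ)_v = −1` then every `u` with `u = 0` or `(−u·a⁻¹, θ)_v = 1` satisfies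
**`|4β′|_v ≤ |u − β′|_v`** — otherwise `u∕β′ ∈ 1 + 4𝔭_v` would be a non-zero square (★ `isSquare_of_valued_sub_one_lt_four_adicCompletion`) and the two symbols would
coincide (★ `hilbertSymbol_mul_sq_left`). [cite: Serre1979, Ch. XIV §4] [cite: Omeara1963, §63B] -/
theorem valued_four_mul_le_valued_sub_of_hilbertSymbol {a β' θ : v.adicCompletion K} (hβ : β' ≠ 0)
    (hclass : hilbertSymbol (v.adicCompletion K) (-(β' * a⁻¹)) θ = -1) (u : v.adicCompletion K)
    (hu : u = 0 ∨ hilbertSymbol (v.adicCompletion K) (-(u * a⁻¹)) θ = 1) :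
    Valued.v (4 * β') ≤ Valued.v (u - β') := by
  by_contra hlt
  rw [not_le, Valuation.map_mul] at hlt
  have h4 : Valued.v (4 : v.adicCompletion K) ≤ 1 := by
    have h := valued_natCast_le_one K v 4
    rwa [Nat.cast_ofNat] at h
  have hβv : Valued.v β' ≠ 0 := (Valuation.ne_zero_iff _).2 hβ
  -- `u = 0` is impossible: `|β′| = |0 − β′| < |4|·|β′| ≤ |β′|`
  have hu0 : u ≠ 0 := by
    rintro rfl
    rw [zero_sub, Valuation.map_neg] at hlt
    exact absurd (lt_of_lt_of_le hlt (mul_le_of_le_one_left' h4)) (lt_irrefl _)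
  -- `u∕β′` is a square
  have hs : IsSquare (u * β'⁻¹) := by
    refine Literature.NumberTheory.LocalFields.isSquare_of_valued_sub_one_lt_four_adicCompletion K v _ ?_
    have hrw : u * β'⁻¹ - 1 = (u - β') * β'⁻¹ := by field_simp
    rw [hrw, Valuation.map_mul, map_inv₀, mul_inv_lt_iff₀ (zero_lt_iff.2 hβv)]
    exact hlt
  obtain ⟨r, hr⟩ := hs
  have hur : u = β' * (r * r) := by rw [← hr]; field_simp
  have hr0 : r ≠ 0 := by
    rintro rfl
    exact hu0 (by rw [hur, mul_zero, mul_zero])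
  rcases hu with h0 | h1
  · exact hu0 h0
  · have hsq : -(u * a⁻¹) = -(β' * a⁻¹) * r ^ 2 := by rw [hur]; ring
    rw [hsq, hilbertSymbol_mul_sq_left _ _ hr0, hclass] at h1
    norm_num at h1

end Separation

/-! ## §2 Uniform non-triviality of the dilated characters on large balls -/

section Nontrivial

variable (K : Type) [Field K] [NumberField K] (v : HeightOneSpectrum (𝓞 K))

/-- **ONE RADIUS FOR ALL LARGE DILATIONS.**  `ψ` an additive character of `K_v` with conductor exponent `d`, `b ≠ 0`: there is `k₁ = k₁(b, d)` such that for all `k ≥ k₁`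
and EVERY `y` with `|b|_v ≤ |y|_v`, the character `x ↦ ψ(y·x)` is NON-trivial on the ball `𝔭^{−k}` (it has level `d − v(y) ≤ d − v(b)`, ★ `HasConductorExp.mulShift`).
[cite: BushnellHenniart2006, §1.7] -/
theorem exists_forall_exists_addChar_ne_one (ψ : AddChar (v.adicCompletion K) Circle) {d : ℤ} (hd : ψ.HasConductorExp d)
    {b : v.adicCompletion K} (hb : b ≠ 0) :
    ∃ k₁ : ℕ, ∀ k : ℕ, k₁ ≤ k → ∀ y : v.adicCompletion K, Valued.v b ≤ Valued.v y →
      ∃ c ∈ primePowBall (v.adicCompletion K) (-(k : ℤ)), ψ (y * c) ≠ 1 := by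
  obtain ⟨n₀, hn₀⟩ := exists_normAbs_eq_inv_zpow hb
  refine ⟨(n₀ - d + 1).toNat, fun k hk y hy => ?_⟩
  have hy0 : y ≠ 0 := by
    intro h
    rw [h, Valuation.map_zero, le_zero_iff] at hy
    exact hb ((Valuation.zero_iff _).1 hy)
  obtain ⟨n, hn⟩ := exists_normAbs_eq_inv_zpow hy0
  have hbn : normAbs (v.adicCompletion K) b ≤ normAbs (v.adicCompletion K) y := (normAbs_le_normAbs_iff_valued v b y).2 hy
  rw [hn₀, hn] at hbn
  have hnle : n ≤ n₀ := (zpow_le_zpow_iff_right_of_lt_one₀ inv_residueFieldCard_pos inv_residueFieldCard_lt_one).1 hbn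
  obtain ⟨c, hc, hne⟩ := (hd.mulShift hn).2
  have htn := Int.self_le_toNat (n₀ - d + 1)
  refine ⟨c, primePowBall_antitone (show (-(k : ℤ)) ≤ d - n - 1 by omega) hc, ?_⟩
  rwa [AddChar.mulShift_apply] at hne

end Nontrivial

/-! ## §3 The generic cone-word closer -/

section Closer

variable (K : Type) [Field K] [NumberField K] (v : HeightOneSpectrum (𝓞 K))
  [MeasurableSpace (v.adicCompletion K)] [BorelSpace (v.adicCompletion K)]

/-- **THE CONE-WORD CLOSER.**  `μ` Haar on `K_v`, `ψ` continuous of conductor exponent `d`; `Z` ANY measurable space with an s-finite measure `ρ`, `G ∈ L¹(ρ)`, `q : Z → K_v`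
measurable, and the CONE WORD `V x = γ · ∫_Z ψ(x·q z)·G z ∂ρ`.  Support letter (a.e.): `q z = 0 ∨ (−q z·a⁻¹, θ)_v = 1`; class letter: `β′ ≠ 0`, `(−β′·a⁻¹, θ)_v = −1`.
THEN **`∫_{x ∈ 𝔭^{−k}} conj ψ(β′x) · V x ∂μ = 0` for all `k ≥ k₁`**, ONE `k₁ = k₁(β′, d)`: after Fubini (★ `setIntegral_integral_mul_addChar_swap`) the inner integral is
`∫_{𝔭^{−k}} ψ((q z − β′)x) dμ`, and `|q z − β′|_v ≥ |4β′|_v` a.e. (§1) makes that character non-trivial on `𝔭^{−k}` for every such `z` at once (§2), so it integrates to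
`0` (★ `setIntegral_addChar_eq_zero_of_exists`). [cite: KudlaRallis1994, §2 (2.10)–(2.12)] [cite: MoeglinVignerasWaldspurger1987, Chap. 2 II.6] -/
theorem exists_forall_setIntegral_conj_addChar_mul_coneWord_eq_zero
    (μ : Measure (v.adicCompletion K)) [μ.IsAddHaarMeasure]
    (ψ : AddChar (v.adicCompletion K) Circle) (hψ : Continuous ψ) {d : ℤ} (hd : ψ.HasConductorExp d)
    {Z : Type*} [MeasurableSpace Z] (ρ : Measure Z) [SFinite ρ] {G : Z → ℂ} (hG : Integrable G ρ)
    {q : Z → v.adicCompletion K} (hq : Measurable q) (γ : ℂ) (V : v.adicCompletion K → ℂ)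
    (hV : ∀ x, V x = γ * ∫ z, ((ψ (x * q z) : Circle) : ℂ) * G z ∂ρ)
    {a β' θ : v.adicCompletion K} (hβ : β' ≠ 0) (hclass : hilbertSymbol (v.adicCompletion K) (-(β' * a⁻¹)) θ = -1)
    (hZ : ∀ᵐ z ∂ρ, q z = 0 ∨ hilbertSymbol (v.adicCompletion K) (-(q z * a⁻¹)) θ = 1) :
    ∃ k₁ : ℕ, ∀ k : ℕ, k₁ ≤ k →
      ∫ x in primePowBall (v.adicCompletion K) (-(k : ℤ)), conj ((ψ (β' * x) : ℂ)) * V x ∂μ = 0 := by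
  haveI : SecondCountableTopology (v.adicCompletion K) := secondCountableTopology_localField (v.adicCompletion K)
  haveI : CharZero (v.adicCompletion K) := charZero_of_injective_algebraMap (algebraMap K (v.adicCompletion K)).injective
  obtain ⟨Cs, hCs, hCo, hCc, hmono, hexh⟩ := exists_addSubgroupFamily_primePowBall (v.adicCompletion K)
  have h4 : (4 : v.adicCompletion K) ≠ 0 := by norm_num
  have h4β : (4 : v.adicCompletion K) * β' ≠ 0 := mul_ne_zero h4 hβ
  obtain ⟨k₁, hk₁⟩ := exists_forall_exists_addChar_ne_one K v ψ hd h4β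
  refine ⟨k₁, fun k hk => ?_⟩
  -- the oscillatory kernel `θ_z = ψ((q z − β′)·)`
  set θf : Z → AddChar (v.adicCompletion K) Circle := fun z => ψ.mulShift (q z - β') with hθf
  have hθapply : ∀ z x, ((θf z x : Circle) : ℂ) = ((ψ ((q z - β') * x) : Circle) : ℂ) := fun z x => by
    rw [hθf, AddChar.mulShift_apply]
  have hθm : Measurable fun p : v.adicCompletion K × Z => ((θf p.2 p.1 : Circle) : ℂ) := by
    have h : (fun p : v.adicCompletion K × Z => ((θf p.2 p.1 : Circle) : ℂ)) =
        fun p => ((ψ ((q p.2 - β') * p.1) : Circle) : ℂ) := funext fun p => hθapply p.2 p.1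
    rw [h]
    exact (continuous_subtype_val.comp hψ).measurable.comp (((hq.comp measurable_snd).sub measurable_const).mul measurable_fst)
  -- the integrand, rewritten: `conj ψ(β′x) · V x = γ · ∫_Z G z · θ_z(x) ∂ρ`
  have hint : ∀ x, conj ((ψ (β' * x) : ℂ)) * V x = γ * ∫ z, G z * ((θf z x : Circle) : ℂ) ∂ρ := by
    intro x
    rw [hV x, ← mul_assoc, mul_comm (conj _) γ, mul_assoc, ← integral_const_mul]
    congr 1
    refine integral_congr_ae (Eventually.of_forall fun z => ?_)
    dsimp only
    rw [hθapply, sub_mul, AddChar.map_sub_eq_div, div_eq_mul_inv, Circle.coe_mul, Circle.coe_inv, conj_coe_addChar,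
      AddChar.map_neg_eq_inv, Circle.coe_inv, mul_comm (q z) x]
    ring
  rw [← hCs k, setIntegral_congr_fun (hCo k).measurableSet (fun x _ => hint x), integral_const_mul,
    setIntegral_integral_mul_addChar_swap μ ρ (hCc k).measure_lt_top.ne hG θf hθm]
  -- for `ρ`-a.e. `z` the inner character integral vanishes (uniformly in `z` once `k ≥ k₁`)
  have hae : ∀ᵐ z ∂ρ, G z * (∫ x in (Cs k : Set (v.adicCompletion K)), ((θf z x : Circle) : ℂ) ∂μ) = 0 := by
    filter_upwards [hZ] with z hz
    obtain ⟨c, hc, hne⟩ := hk₁ k hk (q z - β') (valued_four_mul_le_valued_sub_of_hilbertSymbol K v hβ hclass (q z) hz)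
    rw [← hCs k] at hc
    rw [setIntegral_addChar_eq_zero_of_exists μ (Cs k) (hCo k).measurableSet (θf z) hc ?_, mul_zero]
    rw [hθapply, Ne, Circle.coe_eq_one]
    exact hne
  rw [integral_congr_ae hae, integral_zero, mul_zero]

end Closer

/-! ## §4 THE D-2 SOCKET OF RECORD ON THE BALL ROAD: ★ p863475's `hV` letter from the CONE WORD -/

section BallRoad

variable (L : Type) [Field L] [NumberField L] [IsCMField L]
variable {N M n : ℕ} (e : Fin N × Fin M ≃ Fin n)
  (dV : Fin N → L) (hdV : ∀ i, IsCMField.complexConj L (dV i) = dV i)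
  (dW : Fin M → L) (hdW : ∀ i, IsCMField.complexConj L (dW i) = dW i)

variable {ι : skewMatrices ((IsCMField.complexConj L : L ≃ₐ[Fp L] L) : L →+* L) ((gramR L e dV hdV dW hdW).map (algebraMap (Fp L) L)) → Type}

variable [∀ v : HeightOneSpectrum (𝓞 ↥(maximalRealSubfield L)), MeasurableSpace (v.adicCompletion ↥(maximalRealSubfield L))]
  [∀ v : HeightOneSpectrum (𝓞 ↥(maximalRealSubfield L)), BorelSpace (v.adicCompletion ↥(maximalRealSubfield L))]

/-- **ROW D-2'S `hV` LETTER FROM THE CONE WORD (the ball road's socket of record, (σ-A) desk WORD #4).**  Frame `S₁ val I Tf V` (★ p863475's), Haar measures `μ v`, the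
corner character scalars `σc X v ≠ 0`, the ball currency `hVdef′` of ★ p863521 (`V X j h i v k = ∫_{𝔭^{−k}} conj ψ_v(σc x)·N₂val x dμ_v`); BY VALUE the CONE DATA of the
stage functional ([A4-an]): measurable spaces `Z v`, s-finite measures `ρ`, densities `G ∈ L¹(ρ)`, measurable phases `q : Z v → L⁺_v`, scalars `γ`, class scalars `a X j h v`
(the Gram determinant of the complementary hermitian space read in `L⁺_v`, up to the road's sign), with the three letters
`hcone : N₂val X j h i v x = γ·∫ ψ_v(x·q z)·G z ∂ρ` (the Radon presentation, [A4-an]), `hZ : ∀ᵐ z ∂ρ, q z = 0 ∨ (−q z·a⁻¹, θ)_v = 1` (★ [A4-alg] Witt on the carrier),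
`hclass′ : dead ⇒ (−σc X v·a⁻¹, θ)_v = −1` (★ p863939 `hilbertSymbol_eq_neg_one_of_dead`, `u := −σc X v·(a X j h v)⁻¹`)
⟹ the `hV` binder of ★ p863475 `hdead_of_facePresentations_rows` BYTES: at a dead bad place the ball values vanish for all large `k` (§3).  No line model, no functional,
no ball-stability letter, no `hΨ`. [cite: KudlaRallis1994, §2 (2.10)–(2.12)] [cite: MoeglinVignerasWaldspurger1987, Chap. 2 II.6] -/
theorem hV_faces_of_coneWord {φ : Type*}
    (S₁ : Finset (HeightOneSpectrum (𝓞 ↥(maximalRealSubfield L))))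
    (val : Matrix (Fin n) (Fin n) L → ↥(maximalRealSubfield L))
    (I : ∀ X : skewMatrices ((IsCMField.complexConj L : L ≃ₐ[Fp L] L) : L →+* L) ((gramR L e dV hdV dW hdW).map (algebraMap (Fp L) L)),
      ι X → HA L e dV hdV dW hdW → Finset φ)
    (Tf : ∀ X : skewMatrices ((IsCMField.complexConj L : L ≃ₐ[Fp L] L) : L →+* L) ((gramR L e dV hdV dW hdW).map (algebraMap (Fp L) L)),
      ι X → HA L e dV hdV dW hdW → Finset (HeightOneSpectrum (𝓞 ↥(maximalRealSubfield L))))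
    (V : ∀ X : skewMatrices ((IsCMField.complexConj L : L ≃ₐ[Fp L] L) : L →+* L) ((gramR L e dV hdV dW hdW).map (algebraMap (Fp L) L)),
      ι X → HA L e dV hdV dW hdW → φ → HeightOneSpectrum (𝓞 ↥(maximalRealSubfield L)) → ℕ → ℂ)
    -- Haar measures and the corner character scalars
    (μ : ∀ v : HeightOneSpectrum (𝓞 ↥(maximalRealSubfield L)), Measure (v.adicCompletion ↥(maximalRealSubfield L))) [∀ v, (μ v).IsAddHaarMeasure]
    (σc : skewMatrices ((IsCMField.complexConj L : L ≃ₐ[Fp L] L) : L →+* L) ((gramR L e dV hdV dW hdW).map (algebraMap (Fp L) L)) →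
      ∀ v : HeightOneSpectrum (𝓞 ↥(maximalRealSubfield L)), v.adicCompletion ↥(maximalRealSubfield L))
    (hσ : ∀ X v, σc X v ≠ 0)
    -- THE CONE DATA OF THE STAGE FUNCTIONAL (BY VALUE, [A4-an]): carrier spaces, Radon measures, densities, phases, scalars, class scalars
    (Z : HeightOneSpectrum (𝓞 ↥(maximalRealSubfield L)) → Type*) [∀ v, MeasurableSpace (Z v)]
    (ρ : ∀ X : skewMatrices ((IsCMField.complexConj L : L ≃ₐ[Fp L] L) : L →+* L) ((gramR L e dV hdV dW hdW).map (algebraMap (Fp L) L)),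
      ι X → HA L e dV hdV dW hdW → φ → ∀ v : HeightOneSpectrum (𝓞 ↥(maximalRealSubfield L)), Measure (Z v))
    (hρ : ∀ X j h i v, SFinite (ρ X j h i v))
    (G : ∀ X : skewMatrices ((IsCMField.complexConj L : L ≃ₐ[Fp L] L) : L →+* L) ((gramR L e dV hdV dW hdW).map (algebraMap (Fp L) L)),
      ι X → HA L e dV hdV dW hdW → φ → ∀ v : HeightOneSpectrum (𝓞 ↥(maximalRealSubfield L)), Z v → ℂ)
    (hG : ∀ X j h i v, Integrable (G X j h i v) (ρ X j h i v))
    (q : ∀ X : skewMatrices ((IsCMField.complexConj L : L ≃ₐ[Fp L] L) : L →+* L) ((gramR L e dV hdV dW hdW).map (algebraMap (Fp L) L)),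
      ι X → HA L e dV hdV dW hdW → φ → ∀ v : HeightOneSpectrum (𝓞 ↥(maximalRealSubfield L)), Z v → v.adicCompletion ↥(maximalRealSubfield L))
    (hq : ∀ X j h i v, Measurable (q X j h i v))
    (γ : ∀ X : skewMatrices ((IsCMField.complexConj L : L ≃ₐ[Fp L] L) : L →+* L) ((gramR L e dV hdV dW hdW).map (algebraMap (Fp L) L)),
      ι X → HA L e dV hdV dW hdW → φ → HeightOneSpectrum (𝓞 ↥(maximalRealSubfield L)) → ℂ)
    (a : ∀ X : skewMatrices ((IsCMField.complexConj L : L ≃ₐ[Fp L] L) : L →+* L) ((gramR L e dV hdV dW hdW).map (algebraMap (Fp L) L)),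
      ι X → HA L e dV hdV dW hdW → ∀ v : HeightOneSpectrum (𝓞 ↥(maximalRealSubfield L)), v.adicCompletion ↥(maximalRealSubfield L))
    -- the class letter at dead places and the support letter on the carrier
    (hclass' : ∀ X : skewMatrices ((IsCMField.complexConj L : L ≃ₐ[Fp L] L) : L →+* L) ((gramR L e dV hdV dW hdW).map (algebraMap (Fp L) L)),
      (X : Matrix (Fin n) (Fin n) L) ≠ 0 → (X : Matrix (Fin n) (Fin n) L).det = 0 → ∀ (j : ι X) (h : HA L e dV hdV dW hdW), ∀ v ∈ Tf X j h,
      ¬ (hilbertSymbol (v.adicCompletion ↥(maximalRealSubfield L)) (algebraMap ↥(maximalRealSubfield L) _ (val X))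
          (algebraMap ↥(maximalRealSubfield L) _ (cmQuadraticGenerator L : ↥(maximalRealSubfield L))) = -1 ↔ v ∈ S₁) →
      hilbertSymbol (v.adicCompletion ↥(maximalRealSubfield L)) (-(σc X v * (a X j h v)⁻¹))
        (algebraMap ↥(maximalRealSubfield L) (v.adicCompletion ↥(maximalRealSubfield L)) (cmQuadraticGenerator L : ↥(maximalRealSubfield L))) = -1)
    (hZ : ∀ X : skewMatrices ((IsCMField.complexConj L : L ≃ₐ[Fp L] L) : L →+* L) ((gramR L e dV hdV dW hdW).map (algebraMap (Fp L) L)),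
      (X : Matrix (Fin n) (Fin n) L) ≠ 0 → (X : Matrix (Fin n) (Fin n) L).det = 0 → ∀ (j : ι X) (h : HA L e dV hdV dW hdW), ∀ i ∈ I X j h, ∀ v ∈ Tf X j h,
      ∀ᵐ z ∂(ρ X j h i v), q X j h i v z = 0 ∨
        hilbertSymbol (v.adicCompletion ↥(maximalRealSubfield L)) (-(q X j h i v z * (a X j h v)⁻¹))
          (algebraMap ↥(maximalRealSubfield L) (v.adicCompletion ↥(maximalRealSubfield L)) (cmQuadraticGenerator L : ↥(maximalRealSubfield L))) = 1)
    -- the stage-B values, their ball currency (★ p863521 §3 BYTES) and the CONE WORD ([A4-an])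
    (N₂val : ∀ X : skewMatrices ((IsCMField.complexConj L : L ≃ₐ[Fp L] L) : L →+* L) ((gramR L e dV hdV dW hdW).map (algebraMap (Fp L) L)),
      ι X → HA L e dV hdV dW hdW → φ → ∀ v : HeightOneSpectrum (𝓞 ↥(maximalRealSubfield L)), v.adicCompletion ↥(maximalRealSubfield L) → ℂ)
    (hVdef' : ∀ X : skewMatrices ((IsCMField.complexConj L : L ≃ₐ[Fp L] L) : L →+* L) ((gramR L e dV hdV dW hdW).map (algebraMap (Fp L) L)),
      (X : Matrix (Fin n) (Fin n) L) ≠ 0 → (X : Matrix (Fin n) (Fin n) L).det = 0 → ∀ (j : ι X) (h : HA L e dV hdV dW hdW), ∀ i ∈ I X j h, ∀ v ∈ Tf X j h, ∀ k : ℕ,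
      V X j h i v k = ∫ x in primePowBall (v.adicCompletion (maximalRealSubfield L)) (-(k : ℤ)),
        conj ((((adeleAddCharAt (maximalRealSubfield L) v) (σc X v * x) : Circle) : ℂ)) * N₂val X j h i v x ∂(μ v))
    (hcone : ∀ X : skewMatrices ((IsCMField.complexConj L : L ≃ₐ[Fp L] L) : L →+* L) ((gramR L e dV hdV dW hdW).map (algebraMap (Fp L) L)),
      (X : Matrix (Fin n) (Fin n) L) ≠ 0 → (X : Matrix (Fin n) (Fin n) L).det = 0 → ∀ (j : ι X) (h : HA L e dV hdV dW hdW), ∀ i ∈ I X j h, ∀ v ∈ Tf X j h,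
      ∀ x : v.adicCompletion ↥(maximalRealSubfield L),
      N₂val X j h i v x = γ X j h i v *
        ∫ z, (((adeleAddCharAt (maximalRealSubfield L) v) (x * q X j h i v z) : Circle) : ℂ) * G X j h i v z ∂(ρ X j h i v)) :
    ∀ X : skewMatrices ((IsCMField.complexConj L : L ≃ₐ[Fp L] L) : L →+* L) ((gramR L e dV hdV dW hdW).map (algebraMap (Fp L) L)),
      (X : Matrix (Fin n) (Fin n) L) ≠ 0 → (X : Matrix (Fin n) (Fin n) L).det = 0 → ∀ (j : ι X) (h : HA L e dV hdV dW hdW), ∀ i ∈ I X j h, ∀ v ∈ Tf X j h,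
      ¬ (hilbertSymbol (v.adicCompletion ↥(maximalRealSubfield L)) (algebraMap ↥(maximalRealSubfield L) _ (val X))
          (algebraMap ↥(maximalRealSubfield L) _ (cmQuadraticGenerator L : ↥(maximalRealSubfield L))) = -1 ↔ v ∈ S₁) →
      ∃ k₁ : ℕ, ∀ k, k₁ ≤ k → V X j h i v k = 0 := by
  intro X hX0 hdet j h i hi v hv hdead
  haveI : SFinite (ρ X j h i v) := hρ X j h i v
  obtain ⟨d, hd⟩ := (isContinuousNontrivial_adeleAddCharAt ↥(maximalRealSubfield L) v).exists_hasConductorExp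
  obtain ⟨k₁, hk₁⟩ := exists_forall_setIntegral_conj_addChar_mul_coneWord_eq_zero ↥(maximalRealSubfield L) v (μ v)
    (adeleAddCharAt ↥(maximalRealSubfield L) v) (isContinuousNontrivial_adeleAddCharAt ↥(maximalRealSubfield L) v).1 hd
    (ρ X j h i v) (hG X j h i v) (hq X j h i v) (γ X j h i v) (N₂val X j h i v) (fun x => hcone X hX0 hdet j h i hi v hv x)
    (hσ X v) (hclass' X hX0 hdet j h v hv hdead) (hZ X hX0 hdet j h i hi v hv)
  refine ⟨k₁, fun k hk => ?_⟩
  rw [hVdef' X hX0 hdet j h i hi v hv k]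
  exact hk₁ k hk

end BallRoad

/-! ## §5 Square-class bridges for the payer of `hclass′`: local norms do not move the symbol; `−det(V₁ ⊕ H) ≡ a_{V₁}` -/

section Bridge

open Literature.NumberTheory.Rogawski1990 (hilbertSymbol_eq_one_iff_exists_norm_toPlace)

variable (L : Type) [Field L] [NumberField L] [IsCMField L] (v : HeightOneSpectrum (𝓞 ↥(maximalRealSubfield L)))
  (w : PlacesOver L v) (hw : IsCMField.complexConj L • w.1 = w.1)

/-- `θ = cmQuadraticGenerator L` is non-zero in `L⁺_v` (it is not a square in `L⁺`). [folklore] -/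
theorem algebraMap_cmQuadraticGenerator_ne_zero :
    algebraMap ↥(maximalRealSubfield L) (v.adicCompletion ↥(maximalRealSubfield L)) (cmQuadraticGenerator L : ↥(maximalRealSubfield L)) ≠ 0 := by
  rw [Ne, map_eq_zero_iff _ (algebraMap ↥(maximalRealSubfield L) (v.adicCompletion ↥(maximalRealSubfield L))).injective]
  exact fun h => not_isSquare_cmQuadraticGenerator L (by rw [h]; exact IsSquare.zero)

include hw in
/-- **LOCAL NORMS DO NOT MOVE THE SYMBOL**: at a non-split `v` (`w ∣ v` fixed by `c̄`), if `ι_w(n) = σ_w(c)·c` with `c ≠ 0` then `(u·n, θ)_v = (u, θ)_v` for `u ≠ 0`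
(★ `hilbertSymbol_eq_one_iff_exists_norm_toPlace` + bimultiplicativity ★ `hilbertSymbol_adicCompletion_mul_left`). [cite: Omeara1963, §63B (63:10, 63:13a)] -/
theorem hilbertSymbol_mul_localNorm_eq {u n : v.adicCompletion ↥(maximalRealSubfield L)} (hu : u ≠ 0) {c : w.1.adicCompletion L} (hc : c ≠ 0)
    (hn : toPlace v w n = galAdicCompletionMap (L := L) (IsCMField.complexConj L) hw c * c) :
    hilbertSymbol (v.adicCompletion ↥(maximalRealSubfield L)) (u * n)
        (algebraMap ↥(maximalRealSubfield L) _ (cmQuadraticGenerator L : ↥(maximalRealSubfield L))) =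
      hilbertSymbol (v.adicCompletion ↥(maximalRealSubfield L)) u
        (algebraMap ↥(maximalRealSubfield L) _ (cmQuadraticGenerator L : ↥(maximalRealSubfield L))) := by
  have hθ := algebraMap_cmQuadraticGenerator_ne_zero L v
  have hn0 : n ≠ 0 := by
    intro h
    rw [h, map_zero, eq_comm, mul_eq_zero] at hn
    rcases hn with h1 | h1
    · exact hc ((map_eq_zero_iff _ (galAdicCompletionMap (L := L) (IsCMField.complexConj L) hw).injective).1 h1)
    · exact hc h1
  have hnorm : hilbertSymbol (v.adicCompletion ↥(maximalRealSubfield L)) n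
      (algebraMap ↥(maximalRealSubfield L) _ (cmQuadraticGenerator L : ↥(maximalRealSubfield L))) = 1 :=
    (hilbertSymbol_eq_one_iff_exists_norm_toPlace L v w hw hn0).2 ⟨c, hn.symm⟩
  rw [hilbertSymbol_adicCompletion_mul_left ↥(maximalRealSubfield L) v hu hn0 hθ, hnorm, mul_one]

include hw in
/-- **`−det(V₁ ⊕ H) ≡ a_{V₁}` (the bridge for `hclass′`)**: if the class scalar of the road is `dA = −(a₁·n)` with `ι_w(n) = σ_w(c)·c` a local NORM (`c ≠ 0`) — the Gram
determinant of a line `⟨a₁⟩` plus a hyperbolic plane (`det H = −N(c)`) — then for `β ≠ 0`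
**`(−β·dA⁻¹, θ)_v = (β·a₁⁻¹, θ)_v`**, so [A4-close]'s class letter `hclass′` is ★ p863939 `hilbertSymbol_eq_neg_one_of_dead`'s output for the LINE `⟨a₁⟩` by name.
[cite: Omeara1963, §42 (42:17), §63B] [cite: KudlaRallis1994, §2 (2.10)–(2.12)] -/
theorem hilbertSymbol_neg_mul_inv_det_eq {β a₁ n dA : v.adicCompletion ↥(maximalRealSubfield L)} (hβ : β ≠ 0) (ha₁ : a₁ ≠ 0)
    {c : w.1.adicCompletion L} (hc : c ≠ 0) (hn : toPlace v w n = galAdicCompletionMap (L := L) (IsCMField.complexConj L) hw c * c)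
    (hdA : dA = -(a₁ * n)) :
    hilbertSymbol (v.adicCompletion ↥(maximalRealSubfield L)) (-(β * dA⁻¹))
        (algebraMap ↥(maximalRealSubfield L) _ (cmQuadraticGenerator L : ↥(maximalRealSubfield L))) =
      hilbertSymbol (v.adicCompletion ↥(maximalRealSubfield L)) (β * a₁⁻¹)
        (algebraMap ↥(maximalRealSubfield L) _ (cmQuadraticGenerator L : ↥(maximalRealSubfield L))) := by
  have hn0 : n ≠ 0 := by
    intro h
    rw [h, map_zero, eq_comm, mul_eq_zero] at hn
    rcases hn with h1 | h1
    · exact hc ((map_eq_zero_iff _ (galAdicCompletionMap (L := L) (IsCMField.complexConj L) hw).injective).1 h1)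
    · exact hc h1
  have hrw : -(β * dA⁻¹) = β * a₁⁻¹ * n⁻¹ := by
    rw [hdA]
    field_simp
  have hninv : toPlace v w n⁻¹ = galAdicCompletionMap (L := L) (IsCMField.complexConj L) hw c⁻¹ * c⁻¹ := by
    rw [map_inv₀, hn, map_inv₀, mul_inv]
  rw [hrw]
  exact hilbertSymbol_mul_localNorm_eq L v w hw (mul_ne_zero hβ (inv_ne_zero ha₁)) (inv_ne_zero hc) hninv

end Bridge

end Summit.HodgeConjecture.HodgeConjecture.Cruxes.HLiu418.K2LiuLocalSWSeamOfRecord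

end
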